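import Literature.Analysis.FluidPDE.NSRegFourierEnergy
import HarnessLib

/-!
# The `L²` bound of the regularised pressure (Plancherel)

Analysis/FluidPDE file serving the discharge of
`Literature.Analysis.FluidPDE.leray_regularised_wellposed` (Leray 1934, Ch. V §§26–27): for the
classical solution `(u, Ju, p)` of the Leray-regularised Navier–Stokes system synthesized from its
Fourier side (`NSRegFourierSolution.RegSetup`: `u = Re 𝓕 V`, `Ju = Re 𝓕 (m V)`, `p = Re 𝓕 q`,
`q = presSymbol (m V) V = -Σⱼₖ (ξⱼξₖ/|ξ|²) ((mV)ⱼ ⋆ Vₖ)`), the pressure obeys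

  `‖p(t)‖_{L²} ≤ (card ι)² ‖ |Ju(t)| |u(t)| ‖_{L²}`, `t ∈ [0, T]`

(`RegSetup.eLpNorm_p_le`) — the bound `‖p‖ ≤ C ‖|J u| |u|‖` of Ożański–Pooley 2018, (6.85)
(there from the Calderón–Zygmund / Plancherel bound for `p = Σ ∂ᵢ∂ₖ(−Δ)⁻¹((Ju)ᵢuₖ)`), which is
the pressure hypothesis `pressure_two` of Leray's separation of energy
(`LeraySeparationOfEnergy.LerayTailHyp`; Leray 1934, §27, (5.5)). Proof: `|Re z| ≤ |z|`,
Plancherel for `q ∈ L¹ ∩ L²` (`NSFourierPlancherel`), `|q| ≤ Σⱼₖ |(mV)ⱼ ⋆ Vₖ|`, Plancherel for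
each convolution and the convolution theorem `𝓕((mV)ⱼ ⋆ Vₖ) = (JU)ⱼ Uₖ`
(`Real.fourier_mul_convolution_eq`), and `|(JU)ⱼ Uₖ| ≤ |Ju| |u|` (reality of the syntheses).

## References

* J. Leray, *Sur le mouvement d'un liquide visqueux emplissant l'espace*, Acta Math. 63 (1934),
  Ch. V §27, (5.5). [Leray1934]
* W. S. Ożański, B. C. Pooley, *Leray's fundamental work on the Navier–Stokes equations: a modern
  review*, LMS Lecture Note Ser. 452 (2018) = arXiv:1708.09787, (6.85), Lemma 6.34. [OzanskiPooley2018]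
* E. M. Stein, G. Weiss, *Introduction to Fourier Analysis on Euclidean Spaces* (1971), Ch. I Thm. 2.3.
-/

noncomputable section

open MeasureTheory Real Set Filter Topology Function Complex FourierTransform InnerProductSpace
open scoped FourierTransform RealInnerProductSpace ENNReal ComplexConjugate Convolution

namespace Literature.Analysis.FluidPDE.FourierNS

open ClayDatum (reVec reVec_apply)

variable {ι : Type*} [Fintype ι] [DecidableEq ι]

namespace RegSetup

variable (d : RegSetup ι)

/-! ### The pressure symbol in `L¹ ∩ L²` -/

/-- The pressure symbol `q(t)` is integrable for `t ∈ [0, T]` (polynomial decay of every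
order, `decay_q`). [folklore] -/
theorem integrable_q {t : ℝ} (ht : t ∈ Icc 0 d.T) : Integrable (d.q t) volume := by
  obtain ⟨B, hB⟩ := d.decay_q d.K₀
  exact (hB t ht).1.integrable (finrank_lt_of_card_lt d.hK₀) (hB t ht).2

/-- The pressure symbol `q(t)` is square integrable for `t ∈ [0, T]` (bounded and integrable). [folklore] -/
theorem memLp_q {t : ℝ} (ht : t ∈ Icc 0 d.T) : MemLp (d.q t) 2 volume := by
  obtain ⟨B, hB⟩ := d.decay_q d.K₀
  exact memLp_two_of_bound ((hB t ht).1.integrable (finrank_lt_of_card_lt d.hK₀) (hB t ht).2)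
    fun ξ => (hB t ht).1.norm_le ξ

/-- **Plancherel for the pressure**: `‖P(t)‖_{L²} = ‖q(t)‖_{L²}` (`P = 𝓕 q`, `q ∈ L¹ ∩ L²`). [folklore] -/
theorem eLpNorm_P_eq {t : ℝ} (ht : t ∈ Icc 0 d.T) : eLpNorm (d.P t) 2 volume = eLpNorm (d.q t) 2 volume := by
  have h := eLpNorm_fourierIntegral_eq (d.integrable_q ht) (d.memLp_q ht)
  exact h

/-- `‖p(t)‖_{L²} ≤ ‖q(t)‖_{L²}` (`|Re z| ≤ |z|` and Plancherel). [folklore] -/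
theorem eLpNorm_p_le_eLpNorm_q {t : ℝ} (ht : t ∈ Icc 0 d.T) : eLpNorm (d.p t) 2 volume ≤ eLpNorm (d.q t) 2 volume := by
  rw [← d.eLpNorm_P_eq ht]
  refine eLpNorm_mono fun x => ?_
  rw [Real.norm_eq_abs]
  exact Complex.abs_re_le_norm (d.P t x)

/-! ### The convolutions `(mV)ⱼ ⋆ Vₖ` and their syntheses -/

/-- Measurable components of `V(t)`. [folklore] -/
theorem measurable_V_apply (t : ℝ) (l : ι) : Measurable fun ξ => d.V t ξ l :=
  measurable_pi_iff.1 (d.measurable_V t) l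

/-- Measurable multiplied components `m V(t)ₗ`. [folklore] -/
theorem measurable_mV_apply (t : ℝ) (l : ι) : Measurable fun ξ => (d.m ξ : ℂ) * d.V t ξ l :=
  d.hm.measurable.complex_ofReal.mul (d.measurable_V_apply t l)

/-- The convolution `(mV(t))ⱼ ⋆ V(t)ₖ` is integrable (`L¹ ⋆ L¹ ⊂ L¹`). [folklore] -/
theorem integrable_fconv_mV_V {t : ℝ} (ht : t ∈ Icc 0 d.T) (j k : ι) :
    Integrable (fconv (fun ξ => (d.m ξ : ℂ) * d.V t ξ j) (fun ξ => d.V t ξ k)) volume := by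
  rw [fconv_eq]
  exact (d.integrable_mV ht j).integrable_convolution _ (d.integrable_V ht k)

/-- The convolution `(mV(t))ⱼ ⋆ V(t)ₖ` is square integrable (`L¹ ⋆ L² ⊂ L²`). [folklore] -/
theorem memLp_fconv_mV_V {t : ℝ} (ht : t ∈ Icc 0 d.T) (j k : ι) :
    MemLp (fconv (fun ξ => (d.m ξ : ℂ) * d.V t ξ j) (fun ξ => d.V t ξ k)) 2 volume :=
  memLp_two_fconv (d.measurable_mV_apply t j) (d.measurable_V_apply t k) (d.integrable_mV ht j) (d.memLp_V ht k)

/-- **The convolution theorem for the pressure pieces**: `𝓕 ((mV)ⱼ ⋆ Vₖ)(x) = JU(t,x)ⱼ · U(t,x)ₖ`. [folklore] -/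
theorem fourier_fconv_mV_V {t : ℝ} (ht : t ∈ Icc 0 d.T) (j k : ι) (x : EuclideanSpace ℝ ι) :
    𝓕 (fconv (fun ξ => (d.m ξ : ℂ) * d.V t ξ j) (fun ξ => d.V t ξ k)) x = d.JU t x j * d.U t x k := by
  rw [← fourier_mul_fourier' (d.integrable_mV ht j) (d.integrable_V ht k)]
  rfl

/-- `|JU(t,x)ⱼ · U(t,x)ₖ| ≤ |Ju(t,x)| |u(t,x)|` (reality of the syntheses, coordinates against the
Euclidean norm). [folklore] -/
theorem norm_JU_mul_U_le (t : ℝ) (x : EuclideanSpace ℝ ι) (j k : ι) :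
    ‖d.JU t x j * d.U t x k‖ ≤ ‖d.ju t x‖ * ‖d.u t x‖ := by
  rw [norm_mul, ← d.ofReal_ju_apply, ← d.ofReal_u_apply, Complex.norm_real, Complex.norm_real,
    Real.norm_eq_abs, Real.norm_eq_abs]
  exact mul_le_mul (abs_apply_le_norm _ j) (abs_apply_le_norm _ k) (abs_nonneg _) (norm_nonneg _)

/-- **Plancherel for the pressure pieces**:
`‖(mV)ⱼ ⋆ Vₖ‖_{L²} = ‖JUⱼ Uₖ‖_{L²} ≤ ‖ |Ju| |u| ‖_{L²}`. [folklore] -/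
theorem eLpNorm_fconv_mV_V_le {t : ℝ} (ht : t ∈ Icc 0 d.T) (j k : ι) :
    eLpNorm (fconv (fun ξ => (d.m ξ : ℂ) * d.V t ξ j) (fun ξ => d.V t ξ k)) 2 volume ≤
      eLpNorm (fun x => ‖d.ju t x‖ * ‖d.u t x‖) 2 volume := by
  rw [← eLpNorm_fourierIntegral_eq (d.integrable_fconv_mV_V ht j k) (d.memLp_fconv_mV_V ht j k)]
  refine eLpNorm_mono fun x => ?_
  rw [d.fourier_fconv_mV_V ht j k x, Real.norm_of_nonneg (by positivity)]
  exact d.norm_JU_mul_U_le t x j k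

/-! ### The bound -/

/-- `‖q(t)‖_{L²} ≤ Σⱼ Σₖ ‖(mV)ⱼ ⋆ Vₖ‖_{L²}` (`|q| ≤ convSum`, Minkowski). [folklore] -/
theorem eLpNorm_q_le_sum {t : ℝ} (ht : t ∈ Icc 0 d.T) :
    eLpNorm (d.q t) 2 volume ≤
      ∑ j, ∑ k, eLpNorm (fconv (fun ξ => (d.m ξ : ℂ) * d.V t ξ j) (fun ξ => d.V t ξ k)) 2 volume := by
  -- the pieces as functions `ξ ↦ ‖((mV)ⱼ ⋆ Vₖ)(ξ)‖`
  set F : ι → ι → EuclideanSpace ℝ ι → ℝ := fun j k ξ =>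
    ‖fconv (fun ξ => (d.m ξ : ℂ) * d.V t ξ j) (fun ξ => d.V t ξ k) ξ‖ with hF
  have hFm : ∀ j k, AEStronglyMeasurable (F j k) volume := fun j k =>
    (d.memLp_fconv_mV_V ht j k).1.norm
  have hFe : ∀ j k, eLpNorm (F j k) 2 volume =
      eLpNorm (fconv (fun ξ => (d.m ξ : ℂ) * d.V t ξ j) (fun ξ => d.V t ξ k)) 2 volume := fun j k =>
    eLpNorm_norm _
  -- `|q| ≤ Σⱼ Σₖ F j k`
  have h1 : eLpNorm (d.q t) 2 volume ≤ eLpNorm (∑ j, ∑ k, F j k) 2 volume := by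
    refine eLpNorm_mono fun ξ => ?_
    have hq : d.q t ξ = presSymbol (vmul d.m (d.V t)) (d.V t) ξ := rfl
    rw [hq, Finset.sum_apply]
    simp only [Finset.sum_apply]
    have hsum : ∑ j, ∑ k, F j k ξ = convSum (vmul d.m (d.V t)) (d.V t) ξ := by
      simp only [hF, convSum]
    rw [hsum, Real.norm_of_nonneg (convSum_nonneg _ _ _)]
    exact norm_presSymbol_le_convSum _ _ ξ
  refine h1.trans ?_
  -- Minkowski twice
  have h2 : eLpNorm (∑ j, ∑ k, F j k) 2 volume ≤ ∑ j, eLpNorm (∑ k, F j k) 2 volume :=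
    eLpNorm_sum_le (fun j _ => Finset.aestronglyMeasurable_sum _ fun k _ => hFm j k) one_le_two
  refine h2.trans (Finset.sum_le_sum fun j _ => ?_)
  have h3 : eLpNorm (∑ k, F j k) 2 volume ≤ ∑ k, eLpNorm (F j k) 2 volume :=
    eLpNorm_sum_le (fun k _ => hFm j k) one_le_two
  refine h3.trans (Finset.sum_le_sum fun k _ => ?_)
  rw [hFe j k]

/-- **The `L²` bound of the regularised pressure** (Ożański–Pooley 2018, (6.85): `‖p‖ ≤ C‖|Ju||u|‖`;
Leray 1934, §27 (5.5)): for `t ∈ [0, T]`,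
`‖p(t)‖_{L²} ≤ (card ι)² ‖ |Ju(t)| |u(t)| ‖_{L²}`. [cite: OzanskiPooley2018, (6.85)] -/
theorem eLpNorm_p_le {t : ℝ} (ht : t ∈ Icc 0 d.T) :
    eLpNorm (d.p t) 2 volume ≤
      ((Fintype.card ι : ℝ≥0∞) ^ 2) * eLpNorm (fun x => ‖d.ju t x‖ * ‖d.u t x‖) 2 volume := by
  refine (d.eLpNorm_p_le_eLpNorm_q ht).trans ((d.eLpNorm_q_le_sum ht).trans ?_)
  calc ∑ j, ∑ k, eLpNorm (fconv (fun ξ => (d.m ξ : ℂ) * d.V t ξ j) (fun ξ => d.V t ξ k)) 2 volume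
      ≤ ∑ _j : ι, ∑ _k : ι, eLpNorm (fun x => ‖d.ju t x‖ * ‖d.u t x‖) 2 volume :=
        Finset.sum_le_sum fun j _ => Finset.sum_le_sum fun k _ => d.eLpNorm_fconv_mV_V_le ht j k
    _ = ((Fintype.card ι : ℝ≥0∞) ^ 2) * eLpNorm (fun x => ‖d.ju t x‖ * ‖d.u t x‖) 2 volume := by
        rw [Finset.sum_const, Finset.card_univ, Finset.sum_const, Finset.card_univ, nsmul_eq_mul,
          nsmul_eq_mul, sq, mul_assoc]

/-- The same bound with the pointwise product written as `‖Ju‖ ‖u‖` under a real-valued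
`eLpNorm`, in the `ℝ≥0`-constant shape of `LerayTailHyp.pressure_two`. [cite: OzanskiPooley2018, (6.85)] -/
theorem eLpNorm_p_le' {t : ℝ} (ht : t ∈ Icc 0 d.T) :
    eLpNorm (d.p t) 2 volume ≤
      (((Fintype.card ι ^ 2 : ℕ) : NNReal) : ℝ≥0∞) * eLpNorm (fun x => ‖d.ju t x‖ * ‖d.u t x‖) 2 volume := by
  have h := d.eLpNorm_p_le ht
  have hc : (((Fintype.card ι ^ 2 : ℕ) : NNReal) : ℝ≥0∞) = (Fintype.card ι : ℝ≥0∞) ^ 2 := by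
    rw [ENNReal.coe_natCast]; push_cast; ring
  rwa [hc]

end RegSetup

end Literature.Analysis.FluidPDE.FourierNS

end
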